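import Summits.HodgeConjecture.HodgeConjecture.Theorems.Ring2AbelianAllNonsplitWeilSurfaceQuaternion
import HarnessLib

/-!
# The norm obstruction `2 ∉ Nm ℚ(√-3)ˣ` in the first-order gluing calculus of door (h-Σ) (WEIL-2 gen 19)

research route, not a corollary; conditional on HC_CM plus one named minimal statement.

Cell `pub-hodge-ring2-ab-*` (ALL ABELIAN VARIETIES), seat WEIL-2 gen 19, §3 of
`run/shared/lean/pub/pub-hodge-ring2/pub-hodge-ring2-ab-weil-2/DOOR-CYCLES-G19.md`.  At a decomposable member
`Y = Z × A` of the closure of the non-split `(ℚ(√-3), (3,3), [-2])` Weil component (`Z` a split Weil fourfold, `A` a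
Weil surface of class `[-2]`, i.e. a surface with quaternionic multiplication by `D = (-3,2)_ℚ`), the consistency
identity (CONS) of the first-order gluing calculus (gen 18 THEOREM Σ₁, gen 19 THEOREM Σ₅ / PROPOSITION Δ) asks for
rational solutions of one of the following norm equations over `K = ℚ(√-3)` (`Nm(a + b√-3) = a² + 3b²`), in which the
factor `2 = h₁h₂` is the determinant of the `(1,2)` polarization of the `(1,1)` factor and `β ≠ 0` encodes the Weil part
of the curve class attached to a Weil-carrying surface:

* `Nm(β)/2 = Nm(γ)`       (THEOREM Σ₅: the quaternion algebra `K⟨Λ₁⟩ = (-3, Nm β / 2)_ℚ` would have to be split);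
* `Nm(β)/2 = r²`, `r ∈ ℚ` (PROPOSITION Δ, branch (β) at a general QM surface);
* `2·Nm(γ) = 3·Nm(β)`     (PROPOSITION Δ, branch (α); `3 = Nm(1 - ζ₃)`).

All three are impossible for `β ≠ 0`; each is one line from the gen-18 kernel theorem
`norm3_ne_two_mul_norm3 : x² + 3y² = 2(z² + 3w²) → x = y = z = w = 0` (p304276, itself one line from gen 17's
`not_exists_sq_add_three_sq_eq_two`, p301193).  In the SPLIT sibling (`A` of class `[1]`, `h₁h₂ = 1`) the same
identities read `Nm β = Nm γ`, `Nm β = r²`, `2 Nm γ = 3·2·Nm β'`… and are solvable — the obstruction is exactly the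
non-split class.  This file records the three arithmetic statements and the division-algebra form of the first.

## What is proved (0 sorry, no `def`, no named fact; `HC_CM` does not occur)

* `two_mul_norm3_eq_norm3_mul_norm3` — `2(x² + 3y²) = (a² + 3b²)(z² + 3w²)` forces `x = y = 0` and
  `(a = b = 0 ∨ z = w = 0)`: `Nm(β)·Nm(v) = 2·Nm(u)` has only the trivial solutions.
* `halfNorm_quaternion_anisotropic` — for `(a,b) ≠ (0,0)` the quadratic form `⟨1, 3, -r, -3r⟩`, `r = (a²+3b²)/2`
  (the norm form of `(-3, r)_ℚ`), is anisotropic: `(-3, Nm β/2)_ℚ` is a division algebra, hence admits no embedding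
  into a matrix algebra `M₂(ℚ)` (e.g. `End⁰(J(C₂) ⊗ O_K)`).
* `norm3_ne_two_mul_sq` — `a² + 3b² = 2r²` forces `a = b = r = 0` (`Nm β/2` is never a rational square).
* `three_mul_norm3_ne_two_mul_norm3` — `3(a² + 3b²) = 2(x² + 3y²)` forces `a = b = x = y = 0`.

## References

* [vanGeemen1994HodgeAV] B. van Geemen, An introduction to the Hodge conjecture for abelian varieties, LNM 1594
  (1994), (5.4.1), §5 (Weil surfaces of a given discriminant class and quaternion algebras).
-/

namespace Summit.HodgeConjecture.Ring2AbelianAll.NonsplitFrameNormObstruction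

open Summit.HodgeConjecture.Ring2AbelianAll.NonsplitNormObstruction
open Summit.HodgeConjecture.Ring2AbelianAll.NonsplitWeilSurfaceQuaternion

/-- **`Nm(β)·Nm(v) = 2·Nm(u)` has only trivial solutions over `ℚ(√-3)`**: if
`2(x² + 3y²) = (a² + 3b²)(z² + 3w²)` then `x = y = 0` and one of `(a,b)`, `(z,w)` vanishes.  Proof: the composition
identity turns the right side into a single norm `(az + 3bw)² + 3(bz - aw)²`, and `norm3_ne_two_mul_norm3` applies.
This is the arithmetic content of THEOREM Σ₅ (gen 19): the solvability condition `Nm(β)/2 = Nm(γ)` of (CONS) fails.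
research route, not a corollary; conditional on HC_CM plus one named minimal statement. [cite: vanGeemen1994HodgeAV, (5.4.1)] -/
theorem two_mul_norm3_eq_norm3_mul_norm3 (a b x y z w : ℚ)
    (h : 2 * (x ^ 2 + 3 * y ^ 2) = (a ^ 2 + 3 * b ^ 2) * (z ^ 2 + 3 * w ^ 2)) :
    (x = 0 ∧ y = 0) ∧ ((a = 0 ∧ b = 0) ∨ (z = 0 ∧ w = 0)) := by
  have hid := norm3_comp_identity a b z w
  have h2 : (a * z + 3 * b * w) ^ 2 + 3 * (b * z - a * w) ^ 2 = 2 * (x ^ 2 + 3 * y ^ 2) := by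
    rw [h, hid]
  obtain ⟨h1, h1', hx, hy⟩ := norm3_ne_two_mul_norm3 _ _ _ _ h2
  refine ⟨⟨hx, hy⟩, ?_⟩
  subst hx; subst hy
  have hprod : (a ^ 2 + 3 * b ^ 2) * (z ^ 2 + 3 * w ^ 2) = 0 := by
    have : (2 : ℚ) * (0 ^ 2 + 3 * 0 ^ 2) = 0 := by norm_num
    rw [← h]; norm_num
  rcases mul_eq_zero.1 hprod with hab | hzw
  · exact Or.inl ((sq_add_three_sq_eq_zero_iff a b).1 hab)
  · exact Or.inr ((sq_add_three_sq_eq_zero_iff z w).1 hzw)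

/-- **The quaternion algebra `(-3, Nm β / 2)_ℚ` is a division algebra** (`β = a + b√-3 ≠ 0`): its norm form
`x² + 3y² - r z² - 3r w²`, `r = (a² + 3b²)/2`, represents zero only trivially over `ℚ`.  Consequently it does not
embed in `M₂(ℚ) = End⁰(J(C₂) ⊗ O_K)` nor in `K = End⁰` of a very general split Weil fourfold — the form in which
THEOREM Σ₅ (gen 19) uses the non-split class `[-2]`.
research route, not a corollary; conditional on HC_CM plus one named minimal statement. [cite: vanGeemen1994HodgeAV, (5.4.1)] -/
theorem halfNorm_quaternion_anisotropic (a b x y z w : ℚ) (hab : ¬ (a = 0 ∧ b = 0))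
    (h : x ^ 2 + 3 * y ^ 2 - (a ^ 2 + 3 * b ^ 2) / 2 * z ^ 2 - 3 * ((a ^ 2 + 3 * b ^ 2) / 2) * w ^ 2 = 0) :
    x = 0 ∧ y = 0 ∧ z = 0 ∧ w = 0 := by
  have h' : 2 * (x ^ 2 + 3 * y ^ 2) = (a ^ 2 + 3 * b ^ 2) * (z ^ 2 + 3 * w ^ 2) := by
    linear_combination 2 * h
  obtain ⟨⟨hx, hy⟩, hrest⟩ := two_mul_norm3_eq_norm3_mul_norm3 a b x y z w h'
  rcases hrest with hab0 | ⟨hz, hw⟩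
  · exact absurd hab0 hab
  · exact ⟨hx, hy, hz, hw⟩

/-- **`Nm β / 2` is never a rational square**: `a² + 3b² = 2r²` forces `a = b = r = 0` (PROPOSITION Δ of gen 19,
branch (β) on a general quaternionic Weil surface: `-(w″)²/ω_A² = Nm β / 2` would have to be a square).
research route, not a corollary; conditional on HC_CM plus one named minimal statement. [folklore] -/
theorem norm3_ne_two_mul_sq (a b r : ℚ) (h : a ^ 2 + 3 * b ^ 2 = 2 * r ^ 2) : a = 0 ∧ b = 0 ∧ r = 0 := by
  obtain ⟨ha, hb, hr, -⟩ := norm3_ne_two_mul_norm3 a b r 0 (by linear_combination h)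
  exact ⟨ha, hb, hr⟩

/-- **`3·Nm β = 2·Nm γ` has only the trivial solution**: `3(a² + 3b²) = 2(x² + 3y²)` forces `a = b = x = y = 0`
(`3·Nm(a + b√-3) = Nm(-3b + a√-3)`, then `norm3_ne_two_mul_norm3`).  PROPOSITION Δ of gen 19, branch (α).
research route, not a corollary; conditional on HC_CM plus one named minimal statement. [folklore] -/
theorem three_mul_norm3_ne_two_mul_norm3 (a b x y : ℚ) (h : 3 * (a ^ 2 + 3 * b ^ 2) = 2 * (x ^ 2 + 3 * y ^ 2)) :
    a = 0 ∧ b = 0 ∧ x = 0 ∧ y = 0 := by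
  obtain ⟨h3b, ha, hx, hy⟩ := norm3_ne_two_mul_norm3 (3 * b) a x y (by linear_combination h)
  refine ⟨ha, ?_, hx, hy⟩
  linarith

end Summit.HodgeConjecture.Ring2AbelianAll.NonsplitFrameNormObstruction
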